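import Mathlib
import HarnessLib
import Literature.Geometry.DiscreteGeometry.SphericalCodeHullEulerFormula
import Summits.AtomisticToContinuum.Crystallization.Theorems.PricedLinkCensusSoftFourRingsFourCycle
import Summits.AtomisticToContinuum.Crystallization.Theorems.PricedLinkCensusSoftFourRingsLinkLocal

/-!
# Soft four-rings: at most three bond triangles at a vertex, and three force a fan

Support file for `SoftFourRings` (route `PricedLinkCensus`, sub-problem `Crystallization`).

For a unit vector `v` with four *link points* `w 0, …, w 3` (close to `v`, pairwise separated at
the 1 % thresholds), consider the set `S` of index pairs `{i, j}` whose points are close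
(`⟪w i, w j⟫ ≥ 1 − 1.01²/2`).  Purely combinatorial facts about 2-subsets of `Fin 4`
(`four_pairs_cycle_or_triangle`, `three_pairs_path_or_triangle_or_claw`, by `decide`) combined
with the landed exclusions of bonded 4-cycles (`no_bonded_four_cycle_one_percent`), link
triangles and link claws (`no_link_triangle_one_percent`, `no_link_claw_one_percent`) give:

* `card_close_pairs_le_three` — at most three of the six pairs are close;
* `exists_fan_of_card_close_pairs_eq_three` — if exactly three pairs are close they form a path
  `σ 0 ∼ σ 1 ∼ σ 2 ∼ σ 3` for a permutation `σ` of the indices (a *three-fan*).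
-/

namespace Summit.AtomisticToContinuum.Crystallization.Theorems

open Real RealInnerProductSpace Literature.Geometry.DiscreteGeometry

/-- Three of the six 2-subsets of `Fin 4` form a path, or contain a triangle or a claw. -/
theorem three_pairs_path_or_triangle_or_claw :
    ∀ S ∈ ((Finset.univ : Finset (Fin 4)).powersetCard 2).powerset, S.card = 3 →
      (∃ i j k l : Fin 4, i ≠ j ∧ i ≠ k ∧ i ≠ l ∧ j ≠ k ∧ j ≠ l ∧ k ≠ l ∧
        S = {{i, j}, {j, k}, {k, l}}) ∨
      (∃ i j k : Fin 4, i ≠ j ∧ j ≠ k ∧ i ≠ k ∧ {i, j} ∈ S ∧ {j, k} ∈ S ∧ {k, i} ∈ S) ∨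
      (∃ i j k l : Fin 4, i ≠ j ∧ i ≠ k ∧ i ≠ l ∧ j ≠ k ∧ j ≠ l ∧ k ≠ l ∧
        {i, j} ∈ S ∧ {i, k} ∈ S ∧ {i, l} ∈ S) := by
  decide

/-- The 2-subsets of `Fin 4` other than the three pairs at `i` are the three pairs avoiding `i`. -/
theorem pair_avoiding_eq :
    ∀ i j k l : Fin 4, [i, j, k, l].Nodup →
      ∀ P : Finset (Fin 4), P.card = 2 →
        P ≠ {i, j} → P ≠ {i, k} → P ≠ {i, l} → P = {j, k} ∨ P = {j, l} ∨ P = {k, l} := by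
  decide

/-- The 2-subsets of `Fin 4` other than the path pairs `{i,j}, {j,k}, {k,l}` are
`{i,k}, {j,l}, {i,l}`. -/
theorem pair_off_path_eq :
    ∀ i j k l : Fin 4, [i, j, k, l].Nodup →
      ∀ P : Finset (Fin 4), P.card = 2 →
        P ≠ {i, j} → P ≠ {j, k} → P ≠ {k, l} → P = {i, k} ∨ P = {j, l} ∨ P = {i, l} := by
  decide

/-- Four of the six 2-subsets of `Fin 4` contain a 4-cycle or a triangle. -/
theorem four_pairs_cycle_or_triangle :
    ∀ S ∈ ((Finset.univ : Finset (Fin 4)).powersetCard 2).powerset, 4 ≤ S.card →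
      (∃ i j k l : Fin 4, i ≠ j ∧ i ≠ k ∧ i ≠ l ∧ j ≠ k ∧ j ≠ l ∧ k ≠ l ∧
        {i, j} ∈ S ∧ {j, k} ∈ S ∧ {k, l} ∈ S ∧ {l, i} ∈ S) ∨
      (∃ i j k : Fin 4, i ≠ j ∧ j ≠ k ∧ i ≠ k ∧ {i, j} ∈ S ∧ {j, k} ∈ S ∧ {k, i} ∈ S) := by
  intro S hS h4
  rw [Finset.mem_powerset] at hS
  obtain ⟨S', hS'S, hS'3⟩ := Finset.exists_subset_card_eq (show 3 ≤ S.card by omega)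
  have hS' : S' ∈ ((Finset.univ : Finset (Fin 4)).powersetCard 2).powerset :=
    Finset.mem_powerset.2 (hS'S.trans hS)
  -- a fourth pair `P ∈ S ∖ S'`
  have hnot : ¬ S ⊆ S' := fun h => by
    have := Finset.card_le_card h
    omega
  obtain ⟨P, hPS, hPS'⟩ := Finset.not_subset.1 hnot
  have hP2 : P.card = 2 := (Finset.mem_powersetCard.1 (hS hPS)).2
  have hne : ∀ Q ∈ S', P ≠ Q := fun Q hQ h => hPS' (h ▸ hQ)
  rcases three_pairs_path_or_triangle_or_claw S' hS' hS'3 with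
    ⟨i, j, k, l, hij, hik, hil, hjk, hjl, hkl, hpath⟩ | ⟨i, j, k, hij, hjk, hik, h1, h2, h3⟩ |
    ⟨i, j, k, l, hij, hik, hil, hjk, hjl, hkl, h1, h2, h3⟩
  · have m1 : ({i, j} : Finset (Fin 4)) ∈ S := hS'S (by rw [hpath]; simp)
    have m2 : ({j, k} : Finset (Fin 4)) ∈ S := hS'S (by rw [hpath]; simp)
    have m3 : ({k, l} : Finset (Fin 4)) ∈ S := hS'S (by rw [hpath]; simp)
    have hnd : [i, j, k, l].Nodup := by simp [hij, hik, hil, hjk, hjl, hkl]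
    rcases pair_off_path_eq i j k l hnd P hP2
        (hne _ (by rw [hpath]; simp)) (hne _ (by rw [hpath]; simp))
        (hne _ (by rw [hpath]; simp)) with rfl | rfl | rfl
    · right
      refine ⟨i, j, k, hij, hjk, hik, m1, m2, ?_⟩
      rw [Finset.pair_comm]; exact hPS
    · right
      refine ⟨j, k, l, hjk, hkl, hjl, m2, m3, ?_⟩
      rw [Finset.pair_comm]; exact hPS
    · left
      refine ⟨i, j, k, l, hij, hik, hil, hjk, hjl, hkl, m1, m2, m3, ?_⟩
      rw [Finset.pair_comm]; exact hPS
  · right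
    exact ⟨i, j, k, hij, hjk, hik, hS'S h1, hS'S h2, hS'S h3⟩
  · have hnd : [i, j, k, l].Nodup := by simp [hij, hik, hil, hjk, hjl, hkl]
    rcases pair_avoiding_eq i j k l hnd P hP2 (hne _ h1) (hne _ h2)
        (hne _ h3) with rfl | rfl | rfl
    · right
      refine ⟨i, j, k, hij, hjk, hik, hS'S h1, hPS, ?_⟩
      rw [Finset.pair_comm]; exact hS'S h2
    · right
      refine ⟨i, j, l, hij, hjl, hil, hS'S h1, hPS, ?_⟩
      rw [Finset.pair_comm]; exact hS'S h3
    · right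
      refine ⟨i, k, l, hik, hkl, hil, hS'S h2, hPS, ?_⟩
      rw [Finset.pair_comm]; exact hS'S h3

section Link

variable {v : EuclideanSpace ℝ (Fin 3)} {w : Fin 4 → EuclideanSpace ℝ (Fin 3)}

/-- Reindexing the link points by four distinct indices keeps the link hypotheses. -/
theorem link_reindex (hvw : ∀ k, (1 - (101 / 100 : ℝ) ^ 2 / 2) ≤ ⟪v, w k⟫ ∧
      ⟪v, w k⟫ ≤ 1 - 1 / (2 * (101 / 100 : ℝ) ^ 2))
    (hsep : ∀ i j, i ≠ j → ⟪w i, w j⟫ ≤ 1 - 1 / (2 * (101 / 100 : ℝ) ^ 2))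
    (hw : ∀ k, ‖w k‖ = 1) {i j k l : Fin 4} (hij : i ≠ j) (hik : i ≠ k) (hil : i ≠ l)
    (hjk : j ≠ k) (hjl : j ≠ l) (hkl : k ≠ l) :
    (∀ m, ‖(![w i, w j, w k, w l]) m‖ = 1) ∧
    (∀ m, (1 - (101 / 100 : ℝ) ^ 2 / 2) ≤ ⟪v, (![w i, w j, w k, w l]) m⟫ ∧
      ⟪v, (![w i, w j, w k, w l]) m⟫ ≤ 1 - 1 / (2 * (101 / 100 : ℝ) ^ 2)) ∧
    (∀ m n, m ≠ n → ⟪(![w i, w j, w k, w l]) m, (![w i, w j, w k, w l]) n⟫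
      ≤ 1 - 1 / (2 * (101 / 100 : ℝ) ^ 2)) := by
  refine ⟨fun m => ?_, fun m => ?_, fun m n hmn => ?_⟩
  · fin_cases m
    exacts [hw i, hw j, hw k, hw l]
  · fin_cases m
    exacts [hvw i, hvw j, hvw k, hvw l]
  · fin_cases m <;> fin_cases n
    all_goals first
      | exact absurd rfl hmn
      | (simp only [Fin.zero_eta, Fin.mk_one, Fin.reduceFinMk, Matrix.cons_val_zero,
          Matrix.cons_val_one, Matrix.cons_val]
         first
          | exact hsep _ _ hij | exact hsep _ _ hij.symm | exact hsep _ _ hik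
          | exact hsep _ _ hik.symm | exact hsep _ _ hil | exact hsep _ _ hil.symm
          | exact hsep _ _ hjk | exact hsep _ _ hjk.symm | exact hsep _ _ hjl
          | exact hsep _ _ hjl.symm | exact hsep _ _ hkl | exact hsep _ _ hkl.symm)

/-- **At most three close pairs among four link points.**  If `S` is a set of index pairs all of
whose point pairs are close, then `#S ≤ 3`: four close pairs would contain a close 4-cycle
(`no_bonded_four_cycle`) or a close triangle (`no_link_triangle`). -/
theorem card_close_pairs_le_three (hv : ‖v‖ = 1) (hw : ∀ k, ‖w k‖ = 1)
    (hvw : ∀ k, (1 - (101 / 100 : ℝ) ^ 2 / 2) ≤ ⟪v, w k⟫ ∧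
      ⟪v, w k⟫ ≤ 1 - 1 / (2 * (101 / 100 : ℝ) ^ 2))
    (hsep : ∀ i j, i ≠ j → ⟪w i, w j⟫ ≤ 1 - 1 / (2 * (101 / 100 : ℝ) ^ 2))
    {S : Finset (Finset (Fin 4))} (hS2 : ∀ P ∈ S, P.card = 2)
    (hS : ∀ i j, ({i, j} : Finset (Fin 4)) ∈ S → (1 - (101 / 100 : ℝ) ^ 2 / 2) ≤ ⟪w i, w j⟫) :
    S.card ≤ 3 := by
  by_contra h4
  push Not at h4
  have hSmem : S ∈ ((Finset.univ : Finset (Fin 4)).powersetCard 2).powerset := by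
    rw [Finset.mem_powerset]
    intro P hP
    rw [Finset.mem_powersetCard]
    exact ⟨Finset.subset_univ _, hS2 P hP⟩
  rcases four_pairs_cycle_or_triangle S hSmem h4 with
    ⟨i, j, k, l, hij, hik, hil, hjk, hjl, hkl, h1, h2, h3, h4⟩ | ⟨i, j, k, hij, hjk, hik, h1, h2, h3⟩
  · obtain ⟨hw', hvw', hsep'⟩ := link_reindex hvw hsep hw hij hik hil hjk hjl hkl
    refine no_bonded_four_cycle_one_percent hv (![w i, w j, w k, w l]) hw' hvw' hsep' ?_
    intro m
    fin_cases m
    · simpa using hS i j h1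
    · simpa using hS j k h2
    · simpa using hS k l h3
    · simpa using hS l i h4
  · -- a fourth index, distinct from `i, j, k`
    have hfourth : ∀ i j k : Fin 4, ∃ l : Fin 4, l ≠ i ∧ l ≠ j ∧ l ≠ k := by decide
    obtain ⟨l, hl⟩ := hfourth i j k
    obtain ⟨hw', hvw', hsep'⟩ := link_reindex hvw hsep hw hij hik hl.1.symm hjk hl.2.1.symm
      hl.2.2.symm
    refine no_link_triangle_one_percent hv (![w i, w j, w k, w l])
      hw' hvw' hsep' ?_ ?_ ?_
    · simpa using hS i j h1
    · simpa using hS j k h2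
    · simpa using hS k i h3

/-- **Three close pairs form a fan.**  If exactly three index pairs are close then, for some
enumeration `i, j, k, l` of `Fin 4`, the close pairs are `{i, j}, {j, k}, {k, l}` (a claw is
excluded by `no_link_claw`, a triangle by `no_link_triangle`). -/
theorem exists_fan_of_card_close_pairs_eq_three (hv : ‖v‖ = 1) (hw : ∀ k, ‖w k‖ = 1)
    (hvw : ∀ k, (1 - (101 / 100 : ℝ) ^ 2 / 2) ≤ ⟪v, w k⟫ ∧
      ⟪v, w k⟫ ≤ 1 - 1 / (2 * (101 / 100 : ℝ) ^ 2))
    (hsep : ∀ i j, i ≠ j → ⟪w i, w j⟫ ≤ 1 - 1 / (2 * (101 / 100 : ℝ) ^ 2))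
    {S : Finset (Finset (Fin 4))} (hS2 : ∀ P ∈ S, P.card = 2)
    (hS : ∀ i j, ({i, j} : Finset (Fin 4)) ∈ S → (1 - (101 / 100 : ℝ) ^ 2 / 2) ≤ ⟪w i, w j⟫)
    (h3 : S.card = 3) :
    ∃ i j k l : Fin 4, i ≠ j ∧ i ≠ k ∧ i ≠ l ∧ j ≠ k ∧ j ≠ l ∧ k ≠ l ∧
      S = {{i, j}, {j, k}, {k, l}} := by
  have hSmem : S ∈ ((Finset.univ : Finset (Fin 4)).powersetCard 2).powerset := by
    rw [Finset.mem_powerset]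
    intro P hP
    rw [Finset.mem_powersetCard]
    exact ⟨Finset.subset_univ _, hS2 P hP⟩
  rcases three_pairs_path_or_triangle_or_claw S hSmem h3 with
    hpath | ⟨i, j, k, hij, hjk, hik, h1, h2, h3⟩ | ⟨i, j, k, l, hij, hik, hil, hjk, hjl, hkl, h1, h2, h3⟩
  · exact hpath
  · exfalso
    have hfourth : ∀ i j k : Fin 4, ∃ l : Fin 4, l ≠ i ∧ l ≠ j ∧ l ≠ k := by decide
    obtain ⟨l, hl⟩ := hfourth i j k
    obtain ⟨hw', hvw', hsep'⟩ := link_reindex hvw hsep hw hij hik hl.1.symm hjk hl.2.1.symm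
      hl.2.2.symm
    refine no_link_triangle_one_percent hv (![w i, w j, w k, w l]) hw' hvw' hsep' ?_ ?_ ?_
    · simpa using hS i j h1
    · simpa using hS j k h2
    · simpa using hS k i h3
  · exfalso
    obtain ⟨hw', hvw', hsep'⟩ := link_reindex hvw hsep hw hij hik hil hjk hjl hkl
    refine no_link_claw_one_percent hv (![w i, w j, w k, w l]) hw' hvw' hsep' ?_ ?_ ?_
    · simpa using hS i j h1
    · simpa using hS i k h2
    · simpa using hS i l h3

end Link

end Summit.AtomisticToContinuum.Crystallization.Theorems
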